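import Summits.AnomalousDissipation.AnomalousDissipation.Theorems.SawtoothPulseCascadeK1LocalisedCascadeRatioClassStepV

/-!
# K1loc, line `Spectral` / thin start — helper: CANONICAL GEOMETRIC FIBRE BLOCKS (the per-block scalar conditions, discharged once)

Helper file of the prover lane on the crux `K1LocalisedCascade` (stmt-AnomalousDissipation-19491), route `SawtoothPulseCascade`
(S-B/S-C assembly seat; the LEDGER ASSEMBLY, arithmetic layer).  The concrete class steps `…RatioBlocks` / `…StripBlocks` leave
per-block SCALAR hypotheses.  For the canonical geometry — blocks `Λ_m = Λ₀·2^m`, cut-offs `Q₂^m = ⌊q_n Λ_m/q_d⌋` (margin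
`β = q_n/q_d`), `Q₁^m = ⌊2u′Λ_m/v′⌋ + E` (feed slope `α = 2u′/v′`, offset `E` for an escalated feed threshold) — this file proves them
once, for every block, from THREE integer inequalities on the parameters:
* §1 (window-independent): `Q₁^m < Q₂^m` and the feed inclusion `u′Λ_{m+1} ≤ v′(Q₁^m + 1)` from the separation
  `2u′q_dΛ₀ + (E+2)q_dv′ ≤ q_nv′Λ₀`; the cut-off ratio `r_m = (Q₁^m+Q₂^m)/(Q₂^m−Q₁^m) ≤ r* = ((α+β)Λ₀ + E+1)/((β−α)Λ₀ − E−1)`;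
* §2 ratio window (`u|k_w| ≤ v|n|`): `uQ₂^m < Λ_m(uG − v)` from `uq_n < q_d(uG − v)`; the trapezoid constant
  `A_m ≤ A* = ((v+uG)q_d + uq_n)/((uG−v)q_d − uq_n)` and the layer `τ_m ≤ τ₀/2^m`, `τ₀ = uπq_d/(((uG−v)q_d − uq_n)Λ₀)`;
* §3 strip window (`|k_w| < K`): `K + Q₂^m < Λ_mG` from `Kq_d + q_nΛ₀ < Gq_dΛ₀`; `A_m ≤ A* = (Kq_d + (q_n + Gq_d)Λ₀)/((Gq_d − q_n)Λ₀ − Kq_d)`,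
  `τ_m ≤ τ₀/2^m`, `τ₀ = πq_d/((Gq_d − q_n)Λ₀ − Kq_d)`.
These are exactly the inputs of `K1Window.blockJunk_sum_le` (`…BlockJunk`).  Pure arithmetic; no definitions; no statement about the
crux. [cite: Grafakos2014, §3.1.3] [problem: turb]
-/

-- `Summit.<Summit>.<Problem>`: single-conjunct summit, the duplicate namespace segment is deliberate.
set_option linter.dupNamespace false

noncomputable section

namespace Summit.AnomalousDissipation.AnomalousDissipation.Theorems.SawtoothPulseCascade.K1Window

/-! ## §1 Window-independent facts: blocks, cut-offs, feed, cut-off ratio -/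

/-- The geometric blocks `Λ_m = Λ₀·2^m` are monotone. [folklore] -/
theorem canon_blocks_monotone (Λ0 : ℕ) : Monotone fun m : ℕ => Λ0 * 2 ^ m :=
  fun _ _ h => Nat.mul_le_mul_left _ (Nat.pow_le_pow_right (by norm_num) h)

/-- `Λ₀ ≤ Λ_m`. [folklore] -/
theorem canon_blocks_ge (Λ0 m : ℕ) : Λ0 ≤ Λ0 * 2 ^ m :=
  Nat.le_mul_of_pos_right _ (pow_pos (by norm_num) m)

/-- **Separation of the cut-offs on every block**: `2u′q_dΛ₀ + (E+2)q_dv′ ≤ q_nv′Λ₀` and `Λ₀ ≤ Λ` give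
`2u′q_dΛ + (E+2)q_dv′ ≤ q_nv′Λ`. [folklore] -/
theorem canon_sep_of_le {u' v' qn qd E Λ0 Λ : ℕ} (hv' : 0 < v') (hqd : 0 < qd)
    (hsep : 2 * u' * qd * Λ0 + (E + 2) * qd * v' ≤ qn * v' * Λ0) (hΛ : Λ0 ≤ Λ) :
    2 * u' * qd * Λ + (E + 2) * qd * v' ≤ qn * v' * Λ := by
  -- `Λ₀ > 0` (else the separation is absurd), hence `2u′q_d ≤ q_nv′`, hence the claim for `Λ ≥ Λ₀`
  have hΛ0 : 0 < Λ0 := by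
    rcases Nat.eq_zero_or_pos Λ0 with h | h
    · subst h
      have : 0 < (E + 2) * qd * v' := by positivity
      simp at hsep
      omega
    · exact h
  have h1 : 2 * u' * qd * Λ0 ≤ qn * v' * Λ0 := le_trans (Nat.le_add_right _ _) hsep
  have h2 : 2 * u' * qd ≤ qn * v' := Nat.le_of_mul_le_mul_right h1 hΛ0
  obtain ⟨d, rfl⟩ := Nat.exists_eq_add_of_le hΛ
  have h3 : 2 * u' * qd * d ≤ qn * v' * d := Nat.mul_le_mul_right d h2
  calc 2 * u' * qd * (Λ0 + d) + (E + 2) * qd * v' = (2 * u' * qd * Λ0 + (E + 2) * qd * v') + 2 * u' * qd * d := by ring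
    _ ≤ qn * v' * Λ0 + qn * v' * d := Nat.add_le_add hsep h3
    _ = qn * v' * (Λ0 + d) := by ring

/-- **The cut-offs are separated on every block**: `Q₁ = ⌊2u′Λ/v′⌋ + E < Q₂ = ⌊q_nΛ/q_d⌋`. [folklore] -/
theorem canon_Q₁_lt_Q₂ {u' v' qn qd E Λ0 Λ : ℕ} (hv' : 0 < v') (hqd : 0 < qd)
    (hsep : 2 * u' * qd * Λ0 + (E + 2) * qd * v' ≤ qn * v' * Λ0) (hΛ : Λ0 ≤ Λ) :
    2 * u' * Λ / v' + E < qn * Λ / qd := by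
  have hs := canon_sep_of_le hv' hqd hsep hΛ
  -- `(Q₁ + 1)·q_d ≤ q_nΛ`
  have key : (2 * u' * Λ / v' + E + 1) * qd ≤ qn * Λ := by
    refine Nat.le_of_mul_le_mul_left ?_ hv'
    have hdiv : v' * (2 * u' * Λ / v') ≤ 2 * u' * Λ := Nat.mul_div_le _ _
    calc v' * ((2 * u' * Λ / v' + E + 1) * qd) = (v' * (2 * u' * Λ / v')) * qd + (E + 1) * qd * v' := by ring
      _ ≤ 2 * u' * Λ * qd + (E + 2) * qd * v' := by
          have : (E + 1) * qd * v' ≤ (E + 2) * qd * v' :=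
            Nat.mul_le_mul_right _ (Nat.mul_le_mul_right _ (by omega))
          exact Nat.add_le_add (Nat.mul_le_mul_right _ hdiv) this
      _ = 2 * u' * qd * Λ + (E + 2) * qd * v' := by ring
      _ ≤ qn * v' * Λ := hs
      _ = v' * (qn * Λ) := by ring
  have h2 : 2 * u' * Λ / v' + E + 1 ≤ qn * Λ / qd := (Nat.le_div_iff_mul_le hqd).mpr key
  omega

/-- **The feed inclusion on every block**: `u′Λ_{m+1} = 2u′Λ_m ≤ v′(Q₁^m + 1)` (`Q₁ = ⌊2u′Λ/v′⌋ + E`). [folklore] -/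
theorem canon_feed {u' v' : ℕ} (hv' : 0 < v') (E Λ0 m : ℕ) :
    u' * (Λ0 * 2 ^ (m + 1)) ≤ v' * (2 * u' * (Λ0 * 2 ^ m) / v' + E + 1) := by
  have h := Nat.lt_div_mul_add (a := 2 * u' * (Λ0 * 2 ^ m)) hv'
  have e : u' * (Λ0 * 2 ^ (m + 1)) = 2 * u' * (Λ0 * 2 ^ m) := by rw [pow_succ]; ring
  rw [e, Nat.mul_add, Nat.mul_add, mul_comm v' (2 * u' * (Λ0 * 2 ^ m) / v')]
  omega

/-- **The cut-off ratio of every block**: with `α = 2u′/v′`, `β = q_n/q_d` and `(β − α)Λ₀ ≥ E + 2` (the separation),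
`(Q₁ + Q₂)/(Q₂ − Q₁) ≤ ((α+β)Λ₀ + E + 1)/((β−α)Λ₀ − E − 1)` for `Λ ≥ Λ₀`; also `0 ≤ (Q₁+Q₂)/(Q₂−Q₁)`. [folklore] -/
theorem canon_r_le {u' v' qn qd E Λ0 Λ : ℕ} (hv' : 0 < v') (hqd : 0 < qd)
    (hsep : 2 * u' * qd * Λ0 + (E + 2) * qd * v' ≤ qn * v' * Λ0) (hΛ : Λ0 ≤ Λ) :
    (((2 * u' * Λ / v' + E : ℕ) : ℝ) + ((qn * Λ / qd : ℕ) : ℝ)) / (((qn * Λ / qd : ℕ) : ℝ) - ((2 * u' * Λ / v' + E : ℕ) : ℝ)) ≤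
      ((2 * (u' : ℝ) / v' + (qn : ℝ) / qd) * Λ0 + (E + 1)) / (((qn : ℝ) / qd - 2 * (u' : ℝ) / v') * Λ0 - (E + 1)) := by
  have hv'r : (0 : ℝ) < v' := by exact_mod_cast hv'
  have hqdr : (0 : ℝ) < qd := by exact_mod_cast hqd
  have hΛr : (Λ0 : ℝ) ≤ Λ := by exact_mod_cast hΛ
  set α : ℝ := 2 * (u' : ℝ) / v' with hα
  set β : ℝ := (qn : ℝ) / qd with hβ
  -- floor bounds in `ℝ`
  have hQ1 : ((2 * u' * Λ / v' + E : ℕ) : ℝ) ≤ α * Λ + E := by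
    have h := Nat.cast_div_le (m := 2 * u' * Λ) (n := v') (α := ℝ)
    push_cast at h ⊢
    have : (2 * (u' : ℝ) * Λ) / v' = α * Λ := by rw [hα]; ring
    linarith
  have hQ2hi : ((qn * Λ / qd : ℕ) : ℝ) ≤ β * Λ := by
    have h := Nat.cast_div_le (m := qn * Λ) (n := qd) (α := ℝ)
    push_cast at h ⊢
    have : ((qn : ℝ) * Λ) / qd = β * Λ := by rw [hβ]; ring
    linarith
  have hQ2lo : β * Λ - 1 ≤ ((qn * Λ / qd : ℕ) : ℝ) := by
    have h := Nat.lt_div_mul_add (a := qn * Λ) hqd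
    have h' : ((qn * Λ : ℕ) : ℝ) < ((qn * Λ / qd * qd + qd : ℕ) : ℝ) := by exact_mod_cast h
    push_cast at h'
    have e : β * Λ = ((qn : ℝ) * Λ) / qd := by rw [hβ]; ring
    rw [e, div_sub_one hqdr.ne', div_le_iff₀ hqdr]
    linarith
  -- the separation in `ℝ`: `(β − α)Λ₀ ≥ E + 2`
  have hsepr : (E : ℝ) + 2 ≤ (β - α) * Λ0 := by
    have h : ((2 * u' * qd * Λ0 + (E + 2) * qd * v' : ℕ) : ℝ) ≤ ((qn * v' * Λ0 : ℕ) : ℝ) := by exact_mod_cast hsep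
    push_cast at h
    have e : (β - α) * Λ0 = ((qn : ℝ) * v' * Λ0 - 2 * u' * qd * Λ0) / ((qd : ℝ) * v') := by
      rw [hα, hβ]; field_simp
    rw [e, le_div_iff₀ (by positivity)]
    nlinarith
  have hnum0 : 0 ≤ α + β := by rw [hα, hβ]; positivity
  have hgap : (E : ℝ) + 1 < (β - α) * Λ0 := by linarith
  have hβα : 0 < β - α := by
    by_contra h
    push Not at h
    have : (β - α) * Λ0 ≤ 0 := mul_nonpos_of_nonpos_of_nonneg h (by positivity)
    linarith [(by positivity : (0 : ℝ) ≤ E)]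
  -- compare with the canonical fraction at `Λ`, then monotonicity in `Λ`
  have hden : 0 < (β - α) * Λ - (E + 1) := by nlinarith
  have step1 : (((2 * u' * Λ / v' + E : ℕ) : ℝ) + ((qn * Λ / qd : ℕ) : ℝ)) /
      (((qn * Λ / qd : ℕ) : ℝ) - ((2 * u' * Λ / v' + E : ℕ) : ℝ)) ≤ ((α + β) * Λ + (E + 1)) / ((β - α) * Λ - (E + 1)) := by
    have hd' : 0 < ((qn * Λ / qd : ℕ) : ℝ) - ((2 * u' * Λ / v' + E : ℕ) : ℝ) := by nlinarith
    rw [div_le_div_iff₀ hd' hden]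
    have hnum : ((2 * u' * Λ / v' + E : ℕ) : ℝ) + ((qn * Λ / qd : ℕ) : ℝ) ≤ (α + β) * Λ + (E + 1) := by nlinarith
    have hnum' : 0 ≤ ((2 * u' * Λ / v' + E : ℕ) : ℝ) + ((qn * Λ / qd : ℕ) : ℝ) := by positivity
    have hden' : ((β - α) * Λ - (E + 1)) ≤ ((qn * Λ / qd : ℕ) : ℝ) - ((2 * u' * Λ / v' + E : ℕ) : ℝ) := by nlinarith
    nlinarith [mul_le_mul hnum hden' hden.le (by nlinarith)]
  refine step1.trans ?_
  have := ratioClass_ratio_le (c₁ := α + β) (c₂ := β - α) (Q := (E : ℝ) + 1) hΛr hgap (by positivity) hnum0 hβα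
  simpa [mul_comm] using this

/-- The cut-off ratio is non-negative (`Q₁ < Q₂`). [folklore] -/
theorem canon_r_nonneg {Q₁ Q₂ : ℕ} (h : Q₁ < Q₂) : 0 ≤ (((Q₁ : ℕ) : ℝ) + Q₂) / ((Q₂ : ℝ) - Q₁) := by
  have : (Q₁ : ℝ) < Q₂ := by exact_mod_cast h
  exact div_nonneg (by positivity) (by linarith)

/-! ## §2 The ratio window: shift, trapezoid constant, kernel layer -/

/-- Nat-division bound in `ℝ`: `⌊q_nΛ/q_d⌋ ≤ (q_n/q_d)·Λ`. [folklore] -/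
theorem canon_Q₂_le (qn qd Λ : ℕ) : ((qn * Λ / qd : ℕ) : ℝ) ≤ (qn : ℝ) / qd * Λ := by
  have h := Nat.cast_div_le (m := qn * Λ) (n := qd) (α := ℝ)
  push_cast at h
  rw [div_mul_eq_mul_div]; exact h

/-- **Ratio window: the plateau stays below the chirp shift on every block**: `uq_n < q_d(uG − v)` and `Λ ≥ 1` give
`u·⌊q_nΛ/q_d⌋ < Λ(uG − v)`. [folklore] -/
theorem canon_ratio_shift {u v G qn qd Λ : ℕ} (hq : u * qn < qd * (u * G - v)) (hΛ : 1 ≤ Λ) :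
    u * (qn * Λ / qd) < Λ * (u * G - v) := by
  refine Nat.lt_of_mul_lt_mul_left (a := qd) ?_
  have hdiv : qd * (qn * Λ / qd) ≤ qn * Λ := Nat.mul_div_le _ _
  calc qd * (u * (qn * Λ / qd)) = u * (qd * (qn * Λ / qd)) := by ring
    _ ≤ u * (qn * Λ) := Nat.mul_le_mul_left _ hdiv
    _ = (u * qn) * Λ := by ring
    _ < (qd * (u * G - v)) * Λ := Nat.mul_lt_mul_of_pos_right hq hΛ
    _ = qd * (Λ * (u * G - v)) := by ring

/-- **Ratio window: the trapezoid constant of every block is at most `A* = ((v+uG)q_d + uq_n)/((uG−v)q_d − uq_n)`**, and it is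
positive. [folklore] -/
theorem canon_ratio_A_le {u v G qn qd Λ : ℕ} (hqd : 0 < qd) (hvu : v < u * G) (hq : u * qn < qd * (u * G - v)) (hΛ : 1 ≤ Λ) :
    0 < (((v : ℝ) + u * G) * Λ + u * ((qn * Λ / qd : ℕ) : ℝ)) / (((u : ℝ) * G - v) * Λ - u * ((qn * Λ / qd : ℕ) : ℝ)) ∧
    (((v : ℝ) + u * G) * Λ + u * ((qn * Λ / qd : ℕ) : ℝ)) / (((u : ℝ) * G - v) * Λ - u * ((qn * Λ / qd : ℕ) : ℝ)) ≤
      (((v : ℝ) + u * G) * qd + u * qn) / (((u : ℝ) * G - v) * qd - u * qn) := by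
  have hqdr : (0 : ℝ) < qd := by exact_mod_cast hqd
  have hΛr : (1 : ℝ) ≤ Λ := by exact_mod_cast hΛ
  have hc : (0 : ℝ) < (u : ℝ) * G - v := by
    have : (v : ℝ) < (u : ℝ) * G := by exact_mod_cast hvu
    linarith
  have hqr : (u : ℝ) * qn < qd * ((u : ℝ) * G - v) := by
    have h : ((u * qn : ℕ) : ℝ) < ((qd * (u * G - v) : ℕ) : ℝ) := by exact_mod_cast hq
    rw [Nat.cast_mul, Nat.cast_mul, Nat.cast_sub hvu.le, Nat.cast_mul] at h
    exact h
  set Q : ℝ := ((qn * Λ / qd : ℕ) : ℝ) with hQ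
  have hQ0 : 0 ≤ Q := by positivity
  have hQle : Q ≤ (qn : ℝ) / qd * Λ := canon_Q₂_le qn qd Λ
  -- denominators
  have hden : 0 < ((u : ℝ) * G - v) * Λ - u * Q := by
    have h1 : (u : ℝ) * Q ≤ u * ((qn : ℝ) / qd * Λ) := mul_le_mul_of_nonneg_left hQle (by positivity)
    have h2 : (u : ℝ) * ((qn : ℝ) / qd * Λ) = ((u : ℝ) * qn / qd) * Λ := by ring
    have h3 : (u : ℝ) * qn / qd < (u : ℝ) * G - v := by rw [div_lt_iff₀ hqdr]; linarith
    nlinarith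
  have hden' : 0 < ((u : ℝ) * G - v) * qd - u * qn := by linarith
  have hnum : 0 < ((v : ℝ) + u * G) * Λ + u * Q := by
    nlinarith [hc, hΛr, hQ0, (by positivity : (0 : ℝ) ≤ v), (by positivity : (0 : ℝ) ≤ (u : ℝ) * Q)]
  refine ⟨div_pos hnum hden, ?_⟩
  rw [div_le_div_iff₀ hden hden']
  -- `f(Q) = (cΛ + uQ)/(c′Λ − uQ)` is increasing in `Q ≤ βΛ`, and `f(βΛ)` is the scale-free constant
  have key : (u : ℝ) * Q * qd ≤ u * qn * Λ := by
    have := mul_le_mul_of_nonneg_left hQle (by positivity : (0 : ℝ) ≤ u * qd)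
    have e : (u : ℝ) * qd * ((qn : ℝ) / qd * Λ) = u * qn * Λ := by field_simp
    nlinarith
  nlinarith [mul_nonneg (by positivity : (0 : ℝ) ≤ (v : ℝ) + u * G) (zero_le_one.trans hΛr), hc]

/-- **Ratio window: the kernel layer of the block `Λ₀2^m` is at most `τ₀/2^m`**, `τ₀ = uπq_d/(((uG−v)q_d − uq_n)Λ₀)`, and it is
non-negative. [folklore] -/
theorem canon_ratio_tau_le {u v G qn qd Λ0 : ℕ} (hqd : 0 < qd) (hvu : v < u * G) (hq : u * qn < qd * (u * G - v))
    (hΛ0 : 1 ≤ Λ0) (m : ℕ) :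
    0 ≤ (u : ℝ) * Real.pi / (((u : ℝ) * G - v) * ((Λ0 * 2 ^ m : ℕ) : ℝ) - u * ((qn * (Λ0 * 2 ^ m) / qd : ℕ) : ℝ)) ∧
    (u : ℝ) * Real.pi / (((u : ℝ) * G - v) * ((Λ0 * 2 ^ m : ℕ) : ℝ) - u * ((qn * (Λ0 * 2 ^ m) / qd : ℕ) : ℝ)) ≤
      (u : ℝ) * Real.pi * qd / ((((u : ℝ) * G - v) * qd - u * qn) * Λ0) / 2 ^ m := by
  have hqdr : (0 : ℝ) < qd := by exact_mod_cast hqd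
  have hΛ0r : (1 : ℝ) ≤ Λ0 := by exact_mod_cast hΛ0
  have hc : (0 : ℝ) < (u : ℝ) * G - v := by
    have : (v : ℝ) < (u : ℝ) * G := by exact_mod_cast hvu
    linarith
  have hqr : (u : ℝ) * qn < qd * ((u : ℝ) * G - v) := by
    have h : ((u * qn : ℕ) : ℝ) < ((qd * (u * G - v) : ℕ) : ℝ) := by exact_mod_cast hq
    rw [Nat.cast_mul, Nat.cast_mul, Nat.cast_sub hvu.le, Nat.cast_mul] at h
    exact h
  set Λ : ℕ := Λ0 * 2 ^ m with hΛdef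
  have hΛcast : ((Λ : ℕ) : ℝ) = (Λ0 : ℝ) * 2 ^ m := by rw [hΛdef]; push_cast; ring
  set Q : ℝ := ((qn * Λ / qd : ℕ) : ℝ) with hQ
  have hQle : Q ≤ (qn : ℝ) / qd * Λ := canon_Q₂_le qn qd Λ
  have hden' : 0 < ((u : ℝ) * G - v) * qd - u * qn := by linarith
  -- the block denominator dominates the scale-free one times `Λ = Λ₀2^m`
  have hdom : (((u : ℝ) * G - v) * qd - u * qn) * Λ0 * 2 ^ m / qd ≤ ((u : ℝ) * G - v) * Λ - u * Q := by
    rw [div_le_iff₀ hqdr, hΛcast]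
    have h1 : (u : ℝ) * Q * qd ≤ u * qn * (Λ : ℝ) := by
      have := mul_le_mul_of_nonneg_left hQle (by positivity : (0 : ℝ) ≤ u * qd)
      have e : (u : ℝ) * qd * ((qn : ℝ) / qd * Λ) = u * qn * Λ := by field_simp
      nlinarith
    rw [hΛcast] at h1
    nlinarith
  have hpos' : 0 < (((u : ℝ) * G - v) * qd - u * qn) * Λ0 * 2 ^ m / qd := by positivity
  have hden : 0 < ((u : ℝ) * G - v) * Λ - u * Q := lt_of_lt_of_le hpos' hdom
  refine ⟨div_nonneg (by positivity) hden.le, ?_⟩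
  calc (u : ℝ) * Real.pi / (((u : ℝ) * G - v) * Λ - u * Q)
      ≤ (u : ℝ) * Real.pi / ((((u : ℝ) * G - v) * qd - u * qn) * Λ0 * 2 ^ m / qd) :=
        div_le_div_of_nonneg_left (by positivity) hpos' hdom
    _ = (u : ℝ) * Real.pi * qd / ((((u : ℝ) * G - v) * qd - u * qn) * Λ0) / 2 ^ m := by
        field_simp

/-! ## §3 The strip / low-fibre window: shift, trapezoid constant, kernel layer -/

/-- **Strip window: the plateau stays below the chirp shift on every block**: `Kq_d + q_nΛ₀ < Gq_dΛ₀` and `Λ₀ ≤ Λ` give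
`K + ⌊q_nΛ/q_d⌋ < ΛG`. [folklore] -/
theorem canon_strip_shift {K G qn qd Λ0 Λ : ℕ} (hK : K * qd + qn * Λ0 < G * qd * Λ0) (hΛ : Λ0 ≤ Λ) :
    K + qn * Λ / qd < Λ * G := by
  have hΛ0 : 0 < Λ0 := by
    rcases Nat.eq_zero_or_pos Λ0 with h | h
    · subst h; simp at hK
    · exact h
  have hG : qn < G * qd := by
    have h1 : qn * Λ0 < G * qd * Λ0 := lt_of_le_of_lt (Nat.le_add_left _ _) hK
    exact Nat.lt_of_mul_lt_mul_right h1
  refine Nat.lt_of_mul_lt_mul_left (a := qd) ?_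
  have hdiv : qd * (qn * Λ / qd) ≤ qn * Λ := Nat.mul_div_le _ _
  obtain ⟨d, rfl⟩ := Nat.exists_eq_add_of_le hΛ
  have hd : qn * d ≤ G * qd * d := Nat.mul_le_mul_right d hG.le
  calc qd * (K + qn * (Λ0 + d) / qd) = K * qd + qd * (qn * (Λ0 + d) / qd) := by ring
    _ ≤ K * qd + qn * (Λ0 + d) := Nat.add_le_add_left (Nat.mul_div_le _ _) _
    _ = (K * qd + qn * Λ0) + qn * d := by ring
    _ < G * qd * Λ0 + G * qd * d := add_lt_add_of_lt_of_le hK hd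
    _ = qd * ((Λ0 + d) * G) := by ring

/-- **Strip window: the trapezoid constant of every block is at most
`A* = (Kq_d + (q_n + Gq_d)Λ₀)/((Gq_d − q_n)Λ₀ − Kq_d)`**, and it is positive. [folklore] -/
theorem canon_strip_A_le {K G qn qd Λ0 Λ : ℕ} (hqd : 0 < qd) (hK : K * qd + qn * Λ0 < G * qd * Λ0) (hΛ : Λ0 ≤ Λ) :
    0 < (((K + qn * Λ / qd : ℕ) : ℝ) + ((Λ * G : ℕ) : ℝ)) / (((Λ * G : ℕ) : ℝ) - ((K + qn * Λ / qd : ℕ) : ℝ)) ∧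
    (((K + qn * Λ / qd : ℕ) : ℝ) + ((Λ * G : ℕ) : ℝ)) / (((Λ * G : ℕ) : ℝ) - ((K + qn * Λ / qd : ℕ) : ℝ)) ≤
      ((K : ℝ) * qd + ((qn : ℝ) + G * qd) * Λ0) / (((G : ℝ) * qd - qn) * Λ0 - K * qd) := by
  have hqdr : (0 : ℝ) < qd := by exact_mod_cast hqd
  have hΛr : (Λ0 : ℝ) ≤ Λ := by exact_mod_cast hΛ
  have hKr : (K : ℝ) * qd + qn * Λ0 < G * qd * Λ0 := by exact_mod_cast hK
  have hshift : ((K + qn * Λ / qd : ℕ) : ℝ) < ((Λ * G : ℕ) : ℝ) := by exact_mod_cast canon_strip_shift hK hΛ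
  set Q : ℝ := ((qn * Λ / qd : ℕ) : ℝ) with hQ
  have hQle : Q ≤ (qn : ℝ) / qd * Λ := canon_Q₂_le qn qd Λ
  have hQ0 : 0 ≤ Q := by positivity
  have eKQ : ((K + qn * Λ / qd : ℕ) : ℝ) = (K : ℝ) + Q := by push_cast; rw [hQ]
  have eΛG : ((Λ * G : ℕ) : ℝ) = (Λ : ℝ) * G := by push_cast; rfl
  rw [eKQ, eΛG] at hshift ⊢
  have hden : 0 < (Λ : ℝ) * G - ((K : ℝ) + Q) := by linarith
  have hnum : 0 < (K : ℝ) + Q + Λ * G := by linarith [(by positivity : (0 : ℝ) ≤ (K : ℝ) + Q)]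
  refine ⟨div_pos hnum hden, ?_⟩
  -- step 1: `Q ≤ βΛ` (increasing in `Q`); step 2: decreasing in `Λ ≥ Λ₀` (`ratioClass_ratio_le` with `Q := K`)
  set β : ℝ := (qn : ℝ) / qd with hβ
  have hβΛ0 : (K : ℝ) < ((G : ℝ) - β) * Λ0 := by
    have e : ((G : ℝ) - β) * Λ0 * qd = G * qd * Λ0 - qn * Λ0 := by rw [hβ]; field_simp
    have h : (K : ℝ) * qd < ((G : ℝ) - β) * Λ0 * qd := by rw [e]; linarith
    exact lt_of_mul_lt_mul_right h hqdr.le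
  have hGβ : 0 < (G : ℝ) - β := by
    by_contra h; push Not at h
    have : ((G : ℝ) - β) * Λ0 ≤ 0 := mul_nonpos_of_nonpos_of_nonneg h (by positivity)
    linarith [(by positivity : (0 : ℝ) ≤ K)]
  have hden2 : 0 < ((G : ℝ) - β) * Λ - K := by nlinarith
  have step1 : ((K : ℝ) + Q + Λ * G) / ((Λ : ℝ) * G - (K + Q)) ≤ ((β + G) * Λ + K) / (((G : ℝ) - β) * Λ - K) := by
    rw [div_le_div_iff₀ hden hden2]
    have hQ' : Q ≤ β * Λ := hQle
    nlinarith [mul_nonneg (by positivity : (0 : ℝ) ≤ (K : ℝ) + Λ * G) (sub_nonneg.mpr hQ'),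
      mul_nonneg hQ0 (by positivity : (0 : ℝ) ≤ (Λ : ℝ) * G)]
  refine step1.trans ?_
  have step2 := ratioClass_ratio_le (c₁ := β + G) (c₂ := (G : ℝ) - β) (Q := (K : ℝ)) hΛr hβΛ0 (by positivity)
    (by positivity) hGβ
  refine step2.trans (le_of_eq ?_)
  rw [hβ]
  field_simp
  ring

/-- **Strip window: the kernel layer of the block `Λ₀2^m` is at most `τ₀/2^m`**, `τ₀ = πq_d/((Gq_d − q_n)Λ₀ − Kq_d)`, and it is
non-negative. [folklore] -/
theorem canon_strip_tau_le {K G qn qd Λ0 : ℕ} (hqd : 0 < qd) (hK : K * qd + qn * Λ0 < G * qd * Λ0) (m : ℕ) :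
    0 ≤ Real.pi / ((((Λ0 * 2 ^ m) * G : ℕ) : ℝ) - ((K + qn * (Λ0 * 2 ^ m) / qd : ℕ) : ℝ)) ∧
    Real.pi / ((((Λ0 * 2 ^ m) * G : ℕ) : ℝ) - ((K + qn * (Λ0 * 2 ^ m) / qd : ℕ) : ℝ)) ≤
      Real.pi * qd / (((G : ℝ) * qd - qn) * Λ0 - K * qd) / 2 ^ m := by
  have hqdr : (0 : ℝ) < qd := by exact_mod_cast hqd
  have hKr : (K : ℝ) * qd + qn * Λ0 < G * qd * Λ0 := by exact_mod_cast hK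
  set Λ : ℕ := Λ0 * 2 ^ m with hΛdef
  have hΛcast : ((Λ : ℕ) : ℝ) = (Λ0 : ℝ) * 2 ^ m := by rw [hΛdef]; push_cast; ring
  set Q : ℝ := ((qn * Λ / qd : ℕ) : ℝ) with hQ
  have hQle : Q ≤ (qn : ℝ) / qd * Λ := canon_Q₂_le qn qd Λ
  have eKQ : ((K + qn * Λ / qd : ℕ) : ℝ) = (K : ℝ) + Q := by push_cast; rw [hQ]
  have eΛG : ((Λ * G : ℕ) : ℝ) = (Λ : ℝ) * G := by push_cast; rfl
  rw [eKQ, eΛG]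
  have hden' : 0 < ((G : ℝ) * qd - qn) * Λ0 - K * qd := by linarith
  have h2m : (1 : ℝ) ≤ 2 ^ m := one_le_pow₀ (by norm_num)
  -- the block denominator dominates `((Gq_d − q_n)Λ₀ − Kq_d)·2^m/q_d`
  have hdom : (((G : ℝ) * qd - qn) * Λ0 - K * qd) * 2 ^ m / qd ≤ (Λ : ℝ) * G - ((K : ℝ) + Q) := by
    rw [div_le_iff₀ hqdr, hΛcast]
    have h1 : Q * qd ≤ qn * (Λ : ℝ) := by
      have := mul_le_mul_of_nonneg_right hQle hqdr.le
      have e : (qn : ℝ) / qd * Λ * qd = qn * Λ := by field_simp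
      linarith
    rw [hΛcast] at h1
    have h3 : (K : ℝ) * qd ≤ K * qd * 2 ^ m := le_mul_of_one_le_right (by positivity) h2m
    nlinarith
  have hpos' : 0 < (((G : ℝ) * qd - qn) * Λ0 - K * qd) * 2 ^ m / qd := by positivity
  have hden : 0 < (Λ : ℝ) * G - ((K : ℝ) + Q) := lt_of_lt_of_le hpos' hdom
  refine ⟨div_nonneg Real.pi_pos.le hden.le, ?_⟩
  calc Real.pi / ((Λ : ℝ) * G - ((K : ℝ) + Q)) ≤ Real.pi / ((((G : ℝ) * qd - qn) * Λ0 - K * qd) * 2 ^ m / qd) :=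
        div_le_div_of_nonneg_left Real.pi_pos.le hpos' hdom
    _ = Real.pi * qd / (((G : ℝ) * qd - qn) * Λ0 - K * qd) / 2 ^ m := by
        field_simp

/-! ## §4 Positivity of the block denominators (for the envelope scale `d₀ = 8τ/A + Mδ/(πN)`, which needs `τ > 0`) -/

/-- **Ratio window: the kernel-layer denominator of every block is positive**: `0 < (uG−v)Λ − u⌊q_nΛ/q_d⌋`. [folklore] -/
theorem canon_ratio_den_pos {u v G qn qd Λ : ℕ} (hvu : v < u * G) (hq : u * qn < qd * (u * G - v)) (hΛ : 1 ≤ Λ) :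
    0 < ((u : ℝ) * G - v) * Λ - u * ((qn * Λ / qd : ℕ) : ℝ) := by
  have h1 : ((u * (qn * Λ / qd) : ℕ) : ℝ) < ((Λ * (u * G - v) : ℕ) : ℝ) := by exact_mod_cast canon_ratio_shift hq hΛ
  rw [Nat.cast_mul, Nat.cast_mul, Nat.cast_sub hvu.le, Nat.cast_mul] at h1
  linarith

/-- **Strip window: the kernel-layer denominator of every block is positive**: `0 < ΛG − (K + ⌊q_nΛ/q_d⌋)`. [folklore] -/
theorem canon_strip_den_pos {K G qn qd Λ0 Λ : ℕ} (hK : K * qd + qn * Λ0 < G * qd * Λ0) (hΛ : Λ0 ≤ Λ) :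
    0 < ((Λ * G : ℕ) : ℝ) - ((K + qn * Λ / qd : ℕ) : ℝ) := by
  have h1 : ((K + qn * Λ / qd : ℕ) : ℝ) < ((Λ * G : ℕ) : ℝ) := by exact_mod_cast canon_strip_shift hK hΛ
  linarith

end Summit.AnomalousDissipation.AnomalousDissipation.Theorems.SawtoothPulseCascade.K1Window
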